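import Summits.ABC.StewartYu.PadicW80ParC
import HarnessLib

/-!
# The `p`-adic Waldschmidt parameter record — part D (sequel of `PadicW80ParC`)

Support file (plain definitions and theorems; no named facts): continuation of the twin of
`Waldschmidt1980Params/ParamsB/Sizes/Numeric/Main` on the record `PadicW80Par`
(design, HOME/p1/WP-A4-table.md: `V_max` inside the logarithms `W⋆, G` and an ARBITRARY eliminated size
`1 ≤ V_el ≤ V_max` in `U` — p2's FLAG F-p2-3; `c_S = 2¹⁵` — the `p`-adic zeros-per-`𝔘` ratio; all names carry a
suffix `p` to keep them apart from the archimedean record `W80Par`). [cite: Waldschmidt1980, §3.2–3.5 (pp. 264–274)]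
-/

noncomputable section

open Finset Real
open Literature.NumberTheory.Transcendental Literature.NumberTheory.Transcendental.Waldschmidt1980

namespace Summit.ABC.StewartYu

namespace PadicW80Par

variable {d : ℕ} (P : PadicW80Par d)

/-- **`X/h + 1 ≤ e^{6G}`**: with `h > W⋆/G`,
`X/h ≤ 33 U G/(c_L' m V_θ W⋆) = 33 Aᵐ (m^{2m+1}/m!) (∏Vⱼ) G²/(c_L' m) ≤ e^{3G} e^{G} e^{G}`.
[folklore] -/
theorem Xpt_div_hpar_le : P.Xptp / P.hparp + 1 ≤ Real.exp (6 * P.Gp) := by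
  have hh := P.hpar_pos; have hG := P.G_pos; have hW := P.one_le_Wstar; have hm := two_le_mR P
  have hm0 := mR_pos P; have hVf := P.hVmax1; have hVθ := P.one_le_Vθ; have hV1 := P.one_le_prodV
  -- Step 1: `X/h ≤ X G / W⋆`
  have h1 : P.Xptp / P.hparp ≤ P.Xptp * P.Gp / P.Wstarp := by
    rw [div_le_div_iff₀ hh (by linarith)]
    have := P.Wstar_div_G_lt_hpar
    rw [div_lt_iff₀ hG] at this
    have hX := P.Xpt_nonneg
    nlinarith
  -- Step 2: `X G/W⋆ ≤ Ap^m m^{2m+1} (∏V) G²`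
  have h2 : P.Xptp * P.Gp / P.Wstarp ≤ Ap ^ (d + 1) * mRp d ^ (2 * d + 3) * (∏ j, P.Vs j) * P.Gp ^ 2 := by
    have hX := P.Xpt_le
    rw [div_le_iff₀ (by linarith)]
    have hfac : (1 : ℝ) ≤ (d + 1).factorial := by exact_mod_cast Nat.one_le_iff_ne_zero.mpr (Nat.factorial_ne_zero _)
    have hUeq : P.Up = Ap ^ (d + 1) * (mRp d ^ (2 * d + 3) / (d + 1).factorial) * ((∏ j, P.Vs j) * P.Vel) * P.Wstarp * P.Gp := rfl
    unfold cLp' at hX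
    rw [le_div_iff₀ (by positivity)] at hX
    have hA : (0 : ℝ) ≤ Ap ^ (d + 1) := by unfold Ap; positivity
    have key : P.Xptp * (2 ^ 12 * mRp d * P.Vel) * P.Gp ≤ 33 * (Ap ^ (d + 1) * mRp d ^ (2 * d + 3) * (∏ j, P.Vs j) * P.Gp ^ 2 * P.Wstarp * P.Vel) := by
      have hdiv : mRp d ^ (2 * d + 3) / (d + 1).factorial ≤ mRp d ^ (2 * d + 3) := div_le_self (by positivity) hfac
      calc P.Xptp * (2 ^ 12 * mRp d * P.Vel) * P.Gp ≤ 33 * P.Up * P.Gp := by nlinarith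
        _ = 33 * (Ap ^ (d + 1) * (mRp d ^ (2 * d + 3) / (d + 1).factorial) * (∏ j, P.Vs j) * P.Gp ^ 2 * P.Wstarp * P.Vel) := by
            rw [hUeq]; ring
        _ ≤ 33 * (Ap ^ (d + 1) * mRp d ^ (2 * d + 3) * (∏ j, P.Vs j) * P.Gp ^ 2 * P.Wstarp * P.Vel) := by gcongr
    have h33 : 33 * P.Vel ≤ 2 ^ 12 * mRp d * P.Vel := by nlinarith
    have hZ : 0 ≤ Ap ^ (d + 1) * mRp d ^ (2 * d + 3) * (∏ j, P.Vs j) * P.Gp ^ 2 * P.Wstarp := by positivity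
    nlinarith [mul_le_mul_of_nonneg_left h33 (mul_nonneg hZ P.G_pos.le), P.Xpt_nonneg]
  -- Step 3: the exponential bounds
  have f1 := P.A_pow_mul_le
  have f3 := P.prodV_le_exp_G
  have f4 := P.G_sq_le_exp_G
  have h3 : Ap ^ (d + 1) * mRp d ^ (2 * d + 3) * (∏ j, P.Vs j) * P.Gp ^ 2 ≤ Real.exp (5 * P.Gp) := by
    calc Ap ^ (d + 1) * mRp d ^ (2 * d + 3) * (∏ j, P.Vs j) * P.Gp ^ 2
        = (Ap ^ (d + 1) * mRp d ^ (2 * d + 3)) * (∏ j, P.Vs j) * P.Gp ^ 2 := by ring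
      _ ≤ Real.exp (3 * P.Gp) * Real.exp P.Gp * Real.exp P.Gp := by
          have : (0 : ℝ) ≤ Ap ^ (d + 1) * mRp d ^ (2 * d + 3) := by unfold Ap; positivity
          gcongr
      _ = Real.exp (5 * P.Gp) := by simp only [← Real.exp_add]; ring_nf
  have h4 : Real.exp (5 * P.Gp) + 1 ≤ Real.exp (6 * P.Gp) := by
    have hG1 := P.one_le_G
    have e : Real.exp (6 * P.Gp) = Real.exp (5 * P.Gp) * Real.exp P.Gp := by rw [← Real.exp_add]; ring_nf
    rw [e]
    have h2e : 2 ≤ Real.exp P.Gp := by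
      have := Real.add_one_le_exp P.Gp; linarith
    have h5 : 1 ≤ Real.exp (5 * P.Gp) := Real.one_le_exp (by positivity)
    nlinarith
  linarith [h1, h2, h3, h4]

/-- **`log((X + h)/h) ≤ 6 G`.** [cite: Waldschmidt1980, (3.13)–(3.14) (p. 265)] -/
theorem log_Xpt_div_le : Real.log ((P.Xptp + P.hparp) / P.hparp) ≤ 6 * P.Gp := by
  have hh := P.hpar_pos
  have e : (P.Xptp + P.hparp) / P.hparp = P.Xptp / P.hparp + 1 := by field_simp
  rw [e]
  have h := P.Xpt_div_hpar_le
  have hpos : 0 < P.Xptp / P.hparp + 1 := by have := P.Xpt_nonneg; positivity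
  calc Real.log (P.Xptp / P.hparp + 1) ≤ Real.log (Real.exp (6 * P.Gp)) := Real.log_le_log hpos h
    _ = 6 * P.Gp := Real.log_exp _


/-! ## Part C: sizes vector, inner step, nodes (twins of `Waldschmidt1980Sizes/Numeric`) -/

/-- All the sizes: `V` extended by `V_θ` at the last place. [folklore] -/
def Vallp : Fin (d + 1) → ℝ := Fin.snoc P.Vs P.Vel

/-- All the ranges: `L` extended by `L_θ`. [folklore] -/
def Lallp : Fin (d + 1) → ℕ := Fin.snoc P.Lp P.Lθp

/-- `Vall (castSucc j) = V j`. [folklore] -/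
@[simp] theorem Vall_castSucc (j : Fin d) : P.Vallp (Fin.castSucc j) = P.Vs j := by
  unfold Vallp; rw [Fin.snoc_castSucc]

/-- `Vall last = V_θ`. [folklore] -/
@[simp] theorem Vall_last : P.Vallp (Fin.last d) = P.Vel := by
  unfold Vallp; rw [Fin.snoc_last]

/-- `Lall (castSucc j) = L j`. [folklore] -/
@[simp] theorem Lall_castSucc (j : Fin d) : P.Lallp (Fin.castSucc j) = P.Lp j := by
  unfold Lallp; rw [Fin.snoc_castSucc]

/-- `Lall last = L_θ`. [folklore] -/
@[simp] theorem Lall_last : P.Lallp (Fin.last d) = P.Lθp := by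
  unfold Lallp; rw [Fin.snoc_last]

/-- `1 ≤ Vallᵢ`. [folklore] -/
theorem one_le_Vall (i : Fin (d + 1)) : 1 ≤ P.Vallp i := by
  refine Fin.lastCases ?_ (fun j => ?_) i
  · rw [P.Vall_last]; exact P.one_le_Vθ
  · rw [P.Vall_castSucc]; exact P.hV j

/-- `0 < Vallᵢ`. [folklore] -/
theorem Vall_pos (i : Fin (d + 1)) : 0 < P.Vallp i := lt_of_lt_of_le one_pos (P.one_le_Vall i)

/-! ### The inner step size `t_J = ⌊(T/2ᴶ)/(2m)⌋` -/

/-- `t_J = ⌊(T/2ᴶ)/(2m)⌋`: the number of derivatives given up at each of the `m` inner steps of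
level `J` (Waldschmidt's `(1 − k/2n) q^{−J} T`, Lemma 3.6). [cite: Waldschmidt1980, Lemma 3.6 (p. 272)] -/
def tJp (J : ℕ) : ℕ := P.Tp / 2 ^ J / (2 * (d + 1))

/-- `2^J ≤ L_θ` for `J < J₀` (`2^{J₀} ≤ 2 L_θ`). [folklore] -/
theorem two_pow_le_Lθ {J : ℕ} (hJ : J < P.J₀p) : 2 ^ J ≤ P.Lθp := by
  have h := P.two_pow_le
  have : 2 ^ (J + 1) ≤ 2 ^ P.J₀p := Nat.pow_le_pow_right two_pos hJ
  rw [pow_succ] at this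
  omega

/-- **`T/2ᴶ ≥ 2¹¹ m²`** for `J < J₀` (`T ≥ 2¹¹ m² V_θ L_θ ≥ 2¹¹ m² 2ᴶ`). [folklore] -/
theorem TJ_ge {J : ℕ} (hJ : J < P.J₀p) : 2 ^ 11 * (d + 1) ^ 2 ≤ P.Tp / 2 ^ J := by
  rw [Nat.le_div_iff_mul_le (Nat.pow_pos two_pos)]
  have h := P.T_ge_Lθ
  have hL := P.two_pow_le_Lθ hJ
  have hV := P.one_le_Vθ
  have : ((2 ^ 11 * (d + 1) ^ 2 * 2 ^ J : ℕ) : ℝ) ≤ P.Tp := by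
    refine le_trans ?_ h
    have hL' : ((2 : ℝ) ^ J) ≤ P.Lθp := by exact_mod_cast hL
    have e : ((2 ^ 11 * (d + 1) ^ 2 * 2 ^ J : ℕ) : ℝ) = 2 ^ 11 * mRp d ^ 2 * 2 ^ J := by
      unfold mRp; push_cast; ring
    rw [e]
    have h0 : (0 : ℝ) ≤ 2 ^ 11 * mRp d ^ 2 := by positivity
    have hL0 : (0 : ℝ) ≤ P.Lθp := Nat.cast_nonneg _
    calc (2 : ℝ) ^ 11 * mRp d ^ 2 * 2 ^ J = 2 ^ 11 * mRp d ^ 2 * 1 * 2 ^ J := by ring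
      _ ≤ 2 ^ 11 * mRp d ^ 2 * P.Vel * P.Lθp :=
          mul_le_mul (mul_le_mul_of_nonneg_left hV h0) hL' (by positivity) (mul_nonneg h0 (by linarith))
  exact_mod_cast this

/-- `1 ≤ t_J` for `J < J₀`. [folklore] -/
theorem one_le_tJ {J : ℕ} (hJ : J < P.J₀p) : 1 ≤ P.tJp J := by
  unfold tJp
  rw [Nat.le_div_iff_mul_le (by omega)]
  have := P.TJ_ge hJ
  nlinarith

/-- `2m · t_J ≤ T/2ᴶ`. [folklore] -/
theorem tJ_mul_le (J : ℕ) : 2 * (d + 1) * P.tJp J ≤ P.Tp / 2 ^ J := by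
  unfold tJp; rw [Nat.mul_comm]; exact Nat.div_mul_le_self _ _

/-- `t_J ≤ T`. [folklore] -/
theorem tJ_le_T (J : ℕ) : P.tJp J ≤ P.Tp :=
  ((Nat.div_le_self _ _).trans (Nat.div_le_self _ _))

/-- `t_J ≤ T/(2ᴶ · 2m)` (real). [folklore] -/
theorem tJ_le_real (J : ℕ) : (P.tJp J : ℝ) ≤ P.Tp / (2 ^ J * (2 * mRp d)) := by
  have h1 : ((P.tJp J : ℕ) : ℝ) ≤ ((P.Tp / 2 ^ J : ℕ) : ℝ) / (2 * mRp d) := by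
    unfold tJp
    have := Nat.cast_div_le (α := ℝ) (m := P.Tp / 2 ^ J) (n := 2 * (d + 1))
    have em : ((2 * (d + 1) : ℕ) : ℝ) = 2 * mRp d := by unfold mRp; push_cast; ring
    rwa [em] at this
  have h2 : ((P.Tp / 2 ^ J : ℕ) : ℝ) ≤ (P.Tp : ℝ) / 2 ^ J := by
    have := Nat.cast_div_le (α := ℝ) (m := P.Tp) (n := 2 ^ J)
    push_cast at this; exact this
  have hm := mR_pos P
  calc (P.tJp J : ℝ) ≤ ((P.Tp / 2 ^ J : ℕ) : ℝ) / (2 * mRp d) := h1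
    _ ≤ ((P.Tp : ℝ) / 2 ^ J) / (2 * mRp d) := div_le_div_of_nonneg_right h2 (by positivity)
    _ = P.Tp / (2 ^ J * (2 * mRp d)) := by rw [div_div]

omit P in
/-- `⌊a/b⌋ ≥ a/b − 1` for naturals, as reals. [folklore] -/
private theorem natDiv_ge_real (a b : ℕ) (hb : 0 < b) : (a : ℝ) / b - 1 ≤ ((a / b : ℕ) : ℝ) := by
  have h := Nat.lt_div_mul_add hb (a := a)
  have hb' : (0 : ℝ) < b := by exact_mod_cast hb
  rw [div_sub_one hb'.ne', div_le_iff₀ hb']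
  have : (a : ℝ) < (a / b : ℕ) * b + b := by exact_mod_cast h
  linarith

/-- `t_J ≥ T/(2ᴶ · 2m) − 2` (real). [folklore] -/
theorem tJ_ge_real (J : ℕ) : (P.Tp : ℝ) / (2 ^ J * (2 * mRp d)) - 2 ≤ P.tJp J := by
  have hm := mR_pos P
  have h1 := natDiv_ge_real (P.Tp / 2 ^ J) (2 * (d + 1)) (by omega)
  have h2 := natDiv_ge_real P.Tp (2 ^ J) (Nat.pow_pos two_pos)
  have em : ((2 * (d + 1) : ℕ) : ℝ) = 2 * mRp d := by unfold mRp; push_cast; ring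
  rw [em] at h1
  push_cast at h2
  unfold tJp
  have h3 : ((P.Tp : ℝ) / 2 ^ J - 1) / (2 * mRp d) ≤ ((P.Tp / 2 ^ J : ℕ) : ℝ) / (2 * mRp d) :=
    div_le_div_of_nonneg_right h2 (by positivity)
  have h4 : (P.Tp : ℝ) / (2 ^ J * (2 * mRp d)) - 2 ≤ ((P.Tp : ℝ) / 2 ^ J - 1) / (2 * mRp d) - 1 := by
    rw [← div_div, sub_div]
    have : 1 / (2 * mRp d) ≤ 1 := by
      rw [div_le_one (by positivity)]; linarith [two_le_mR P]
    linarith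
  linarith

/-- `T ≥ 𝔘/(c_T W⋆) − 1` (real). [folklore] -/
theorem T_ge_real : P.𝔘p / (cTp * P.Wstarp) - 1 ≤ P.Tp := by
  unfold Tp
  have e : P.Up / (cTp * 2 ^ (d + 1) * P.Wstarp) = P.𝔘p / (cTp * P.Wstarp) := by
    rw [P.U_eq]; unfold cTp; field_simp
  rw [e]
  have h1 := Nat.lt_floor_add_one (P.𝔘p / (cTp * P.Wstarp))
  linarith

/-! ### The interpolation nodes `kpts = 2^{k+J} S₀ / 2` -/

/-- `2^{k+J} S₀ / 2 = 2^{k+J} ⌊c_S m W⋆⌋` exactly (`S₀` is even). [folklore] -/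
theorem kpts_eq (J k : ℕ) : 2 ^ (k + J) * P.S₀p / 2 = 2 ^ (k + J) * ⌊cSp * mRp d * P.Wstarp⌋₊ := by
  unfold S₀p
  rw [show 2 ^ (k + J) * (2 * ⌊cSp * mRp d * P.Wstarp⌋₊) = 2 ^ (k + J) * ⌊cSp * mRp d * P.Wstarp⌋₊ * 2 by ring,
    Nat.mul_div_cancel _ two_pos]

/-- `kpts ≤ 2^{k+J} c_S m W⋆` (real). [folklore] -/
theorem kpts_le_real (J k : ℕ) : ((2 ^ (k + J) * P.S₀p / 2 : ℕ) : ℝ) ≤ 2 ^ (k + J) * (cSp * mRp d * P.Wstarp) := by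
  rw [P.kpts_eq]; push_cast
  have := Nat.floor_le (show 0 ≤ cSp * mRp d * P.Wstarp by have := P.cS_mul_ge; linarith)
  gcongr

/-- `kpts ≥ 2^{k+J} (c_S m W⋆ − 1)` (real). [folklore] -/
theorem kpts_ge_real (J k : ℕ) : 2 ^ (k + J) * (cSp * mRp d * P.Wstarp - 1) ≤ ((2 ^ (k + J) * P.S₀p / 2 : ℕ) : ℝ) := by
  rw [P.kpts_eq]; push_cast
  have := (Nat.lt_floor_add_one (cSp * mRp d * P.Wstarp)).le
  have h0 : (0 : ℝ) ≤ 2 ^ (k + J) := by positivity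
  nlinarith

/-- `kpts ≤ 2^{d+J₀} S₀` for `k ≤ d`, `J ≤ J₀`. [folklore] -/
theorem kpts_le_nat {J k : ℕ} (hJ : J ≤ P.J₀p) (hk : k ≤ d) : 2 ^ (k + J) * P.S₀p / 2 ≤ 2 ^ (d + P.J₀p) * P.S₀p :=
  (Nat.div_le_self _ _).trans (Nat.mul_le_mul_right _ (Nat.pow_le_pow_right two_pos (by omega)))

/-- **Upper bound `kpts · t_J ≤ 2ᵏ 𝔘`** (`c_S/c_T = 2`). [cite: Waldschmidt1980, Lemma 3.5 (p. 271)] -/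
theorem KT_le (J k : ℕ) : ((2 ^ (k + J) * P.S₀p / 2 : ℕ) : ℝ) * (P.tJp J : ℝ) ≤ 2 ^ k * P.𝔘p := by
  have h1 := P.kpts_le_real J k
  have h2 := P.tJ_le_real J
  have hm := mR_pos P; have hW := P.one_le_Wstar; have hT := P.T_pos; have hTW := P.TWstar_le
  have h0 : (0 : ℝ) ≤ ((2 ^ (k + J) * P.S₀p / 2 : ℕ) : ℝ) := Nat.cast_nonneg _
  have hW0 : 0 < P.Wstarp := by linarith
  have hcS0 : (0 : ℝ) < cSp := by unfold cSp; norm_num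
  calc ((2 ^ (k + J) * P.S₀p / 2 : ℕ) : ℝ) * (P.tJp J : ℝ)
      ≤ (2 ^ (k + J) * (cSp * mRp d * P.Wstarp)) * (P.Tp / (2 ^ J * (2 * mRp d))) :=
        mul_le_mul h1 h2 (Nat.cast_nonneg _) (by positivity)
    _ = 2 ^ k * cSp * (P.Tp * P.Wstarp) / 2 := by
        rw [pow_add]; field_simp
    _ ≤ 2 ^ k * cSp * (P.𝔘p / cTp) / 2 := by gcongr
    _ = 2 ^ k * P.𝔘p := by unfold cSp cTp; ring

/-- **Lower bound `kpts · t_J ≥ (31/32)·2ᵏ 𝔘`** for `J < J₀`. [cite: Waldschmidt1980, Lemma 3.5 (p. 271)] -/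
theorem KT_ge {J : ℕ} (hJ : J < P.J₀p) (k : ℕ) :
    31 / 32 * (2 ^ k * P.𝔘p) ≤ ((2 ^ (k + J) * P.S₀p / 2 : ℕ) : ℝ) * (P.tJp J : ℝ) := by
  have h1 := P.kpts_ge_real J k
  have h2 := P.tJ_ge_real J
  have h3 := P.T_ge_real
  have hm := mR_pos P; have hm2 := two_le_mR P; have hW := P.one_le_Wstar; have hU := P.𝔘_pos
  have hcS := P.cS_mul_ge
  have hWU := P.Wstar_le_𝔘
  -- `2^{J+1} c_S m W⋆ ≤ 𝔘/2^{13}` : `2^{J} ≤ Lθ ≤ 𝔘/(2^14 S₀)` and `S₀ ≥ c_S m W⋆`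
  have hJL : (2 : ℝ) ^ J ≤ P.Lθp := by exact_mod_cast P.two_pow_le_Lθ hJ
  have hLS := P.LθS₀_le
  have hS₀ := P.S₀_ge
  have hsmall : (2 : ℝ) ^ J * (cSp * mRp d * P.Wstarp) ≤ P.𝔘p / 2 ^ 14 := by
    calc (2 : ℝ) ^ J * (cSp * mRp d * P.Wstarp) ≤ P.Lθp * P.S₀p := mul_le_mul hJL hS₀ (by linarith) (Nat.cast_nonneg _)
      _ ≤ P.𝔘p / 2 ^ 14 := hLS
  have ht0 : (0 : ℝ) ≤ P.tJp J := Nat.cast_nonneg _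
  -- `2^J t_J ≥ T/(2m) − 2^{J+1}`
  have h2J : (0 : ℝ) < 2 ^ J := by positivity
  have h2' : (P.Tp : ℝ) / (2 * mRp d) - 2 * 2 ^ J ≤ 2 ^ J * (P.tJp J : ℝ) := by
    have := mul_le_mul_of_nonneg_left h2 h2J.le
    have e : (2 : ℝ) ^ J * (P.Tp / (2 ^ J * (2 * mRp d)) - 2) = P.Tp / (2 * mRp d) - 2 * 2 ^ J := by
      field_simp
    linarith
  -- the main term: `(Ap − 1)(𝔘/(c_T W⋆) − 1)/(2m) ≥ 𝔘/4 − c_S W⋆/2 − 𝔘/(2m c_T W⋆)` with `Ap = c_S m W⋆`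
  set Ap : ℝ := cSp * mRp d * P.Wstarp with hA
  have hA1 : 1 ≤ Ap := le_trans (by norm_num) hcS
  have eA : Ap * (P.𝔘p / (cTp * P.Wstarp)) = 2 * mRp d * P.𝔘p := by
    rw [hA]; unfold cSp cTp; field_simp
  have hmain : 31 / 32 * P.𝔘p ≤ (Ap - 1) * (P.Tp / (2 * mRp d) - 2 * 2 ^ J) := by
    -- (a) `(Ap-1) T/(2m) ≥ (Ap-1)(𝔘/(c_T W⋆) - 1)/(2m)`
    have ha : (Ap - 1) * ((P.𝔘p / (cTp * P.Wstarp) - 1) / (2 * mRp d)) ≤ (Ap - 1) * (P.Tp / (2 * mRp d)) :=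
      mul_le_mul_of_nonneg_left (div_le_div_of_nonneg_right h3 (by positivity)) (by linarith)
    -- (b) expand `(Ap-1)(𝔘/(c_T W⋆) - 1) = Ap 𝔘/(c_T W⋆) - Ap - 𝔘/(c_T W⋆) + 1`
    have hb : (Ap - 1) * ((P.𝔘p / (cTp * P.Wstarp) - 1) / (2 * mRp d)) =
        (2 * mRp d * P.𝔘p - Ap - P.𝔘p / (cTp * P.Wstarp) + 1) / (2 * mRp d) := by
      rw [← eA]; ring
    -- (c) the pieces
    have hc1 : (2 * mRp d * P.𝔘p - Ap - P.𝔘p / (cTp * P.Wstarp) + 1) / (2 * mRp d) =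
        P.𝔘p - Ap / (2 * mRp d) - P.𝔘p / (cTp * P.Wstarp) / (2 * mRp d) + 1 / (2 * mRp d) := by
      field_simp
    have hc2 : Ap / (2 * mRp d) = cSp * P.Wstarp / 2 := by rw [hA]; field_simp
    have hc3 : P.𝔘p / (cTp * P.Wstarp) / (2 * mRp d) ≤ P.𝔘p / 2 ^ 16 := by
      rw [div_div, div_le_div_iff₀ (by unfold cTp; positivity) (by norm_num)]
      unfold cTp
      have : (2 : ℝ) ^ 16 ≤ 2 ^ 14 * P.Wstarp * (2 * mRp d) := by nlinarith
      nlinarith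
    have hc4 : 0 ≤ 1 / (2 * mRp d) := by positivity
    have hWs : cSp * P.Wstarp / 2 ≤ P.𝔘p / 2 ^ 84 := by
      unfold cSp; rw [div_le_div_iff₀ (by norm_num) (by norm_num)]; nlinarith
    -- (d) `(Ap-1) · 2 · 2^J ≤ 2 · 2^J Ap ≤ 𝔘/2^13`
    have hd : (Ap - 1) * (2 * 2 ^ J) ≤ P.𝔘p / 2 ^ 13 := by
      have : (Ap - 1) * (2 * 2 ^ J) ≤ 2 * (2 ^ J * Ap) := by nlinarith
      have h14 : 2 * (P.𝔘p / 2 ^ 14) = P.𝔘p / 2 ^ 13 := by ring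
      rw [hA] at this ⊢; linarith
    have htot : (Ap - 1) * (P.Tp / (2 * mRp d) - 2 * 2 ^ J) = (Ap - 1) * (P.Tp / (2 * mRp d)) - (Ap - 1) * (2 * 2 ^ J) := by ring
    rw [htot]
    have : P.𝔘p - P.𝔘p / 2 ^ 84 - P.𝔘p / 2 ^ 16 - P.𝔘p / 2 ^ 13 ≥ 31 / 32 * P.𝔘p := by nlinarith
    linarith [ha, hb, hc1, hc2, hc3, hc4, hWs, hd]
  -- positivity of the bracket, then the product bound
  have hX : 0 < P.Tp / (2 * mRp d) - 2 * 2 ^ J := by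
    by_contra hneg
    push Not at hneg
    have : (Ap - 1) * (P.Tp / (2 * mRp d) - 2 * 2 ^ J) ≤ 0 := mul_nonpos_of_nonneg_of_nonpos (by linarith) hneg
    linarith [hU]
  have hk1 : 2 ^ k * (Ap - 1) * 2 ^ J ≤ ((2 ^ (k + J) * P.S₀p / 2 : ℕ) : ℝ) := by
    have : (2 : ℝ) ^ k * (Ap - 1) * 2 ^ J = 2 ^ (k + J) * (Ap - 1) := by rw [pow_add]; ring
    rw [this]; exact h1
  calc (31 : ℝ) / 32 * (2 ^ k * P.𝔘p) = 2 ^ k * (31 / 32 * P.𝔘p) := by ring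
    _ ≤ 2 ^ k * ((Ap - 1) * (P.Tp / (2 * mRp d) - 2 * 2 ^ J)) := by gcongr
    _ ≤ 2 ^ k * ((Ap - 1) * (2 ^ J * (P.tJp J : ℝ))) := by
        have hA0 : 0 ≤ Ap - 1 := by linarith
        have h2k : (0 : ℝ) ≤ 2 ^ k := by positivity
        exact mul_le_mul_of_nonneg_left (mul_le_mul_of_nonneg_left h2' hA0) h2k
    _ = (2 ^ k * (Ap - 1) * 2 ^ J) * (P.tJp J : ℝ) := by ring
    _ ≤ ((2 ^ (k + J) * P.S₀p / 2 : ℕ) : ℝ) * (P.tJp J : ℝ) := mul_le_mul_of_nonneg_right hk1 ht0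


/-! ## Part D: the endgame numbers (twin of `PadicW80Par.endgame_numbers`) -/

/-- `#{s < 2n : s odd} = n`. [folklore] -/
private theorem card_odd_range_two_mul (n : ℕ) : ((range (2 * n)).filter Odd).card = n := by
  induction n with
  | zero => simp
  | succ n ih =>
    rw [show 2 * (n + 1) = (2 * n + 1) + 1 by ring, range_add_one, range_add_one, filter_insert, filter_insert]
    have hodd : Odd (2 * n + 1) := ⟨n, rfl⟩
    have heven : ¬ Odd (2 * n) := by rw [Nat.not_odd_iff_even]; exact ⟨n, by ring⟩
    rw [if_pos hodd, if_neg heven, card_insert_of_notMem, ih]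
    simp

/-- `#{s < 2^{J₀} S₀ : s odd} = 2^{J₀} ⌊c_S m W⋆⌋` (`S₀ = 2⌊c_S m W⋆⌋`). [folklore] -/
theorem card_odd_eq : ((range (2 ^ P.J₀p * P.S₀p)).filter Odd).card = 2 ^ P.J₀p * ⌊cSp * mRp d * P.Wstarp⌋₊ := by
  unfold S₀p
  rw [show 2 ^ P.J₀p * (2 * ⌊cSp * mRp d * P.Wstarp⌋₊) = 2 * (2 ^ P.J₀p * ⌊cSp * mRp d * P.Wstarp⌋₊) by ring]
  exact card_odd_range_two_mul _

end PadicW80Par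

end Summit.ABC.StewartYu

end
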